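import Mathlib
import HarnessLib
import Literature.Probability.LatticeModels.IsingLimitLaw
import Literature.Probability.LatticeModels.IsingLimitLawTilt
import Literature.Probability.LatticeModels.IsingLimitLawLaplace

/-!
# Ghost spin: stub `stub_coshTilt` of the line `telegraph-bessel-chain`

Crux stmt-RiemannHypothesis-0453 (`LeeYang.LeeyangPolyaKernelIsingLimit`), line skeleton
`Cruxes/LeeyangPolyaKernelIsingLimit/Lines/Sketch.lean`. This file declares no definition.

The class `IsIsingLimitLaw` of Ising limit laws (weak limits of magnetization laws of finite
ferromagnetic Ising systems with non-negative weights and uniformly bounded Gaussian-exponential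
moments `∫ e^{bu²}`) is closed under the tilt `ν ↦ cosh(cu) ν / ∫ cosh(cu) dν` for `c ≥ 0`.

* Finite level — Griffiths' GHOST SPIN: add to a system `(J, w)` on `Fin n` one spin `s₀` (index `0`
  of `Fin (n + 1)`) of WEIGHT `0`, coupled to site `i` by `c wᵢ / 2` (both matrix entries). The
  energy becomes `E_J(s) + c s₀ M_w(s)`, `M_w = Σ wᵢ sᵢ`, the magnetization is unchanged, and
  summing out `s₀ = ±1` multiplies the Gibbs weight of `s` by `e^{cM} + e^{-cM} = 2 cosh(c M)`;
  hence `∫ f d(law J' w') = ∫ cosh(cu) f d(law J w) / ∫ cosh(cu) d(law J w)`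
  (`integral_isingMagnetizationLaw_ghost`). `J' ≥ 0`, `w' ≥ 0` when `J, w, c ≥ 0`.
* Limit level: along a witness sequence `ν_k → ν` the ghost systems converge weakly to the tilt of
  `ν` (`tendsto_integral_of_tendsto_of_exp_sq_bound` of `IsingLimitLawLaplace`: `cosh(cu) f(u)` is
  continuous and `≤ (‖f‖ + 1) e^{c|u|}`; the denominators are `≥ 1`; the identification of `∫ · dν'`
  by `integral_withDensity_eq_integral_toReal_smul`), and their Gaussian-exponential moments are
  bounded by `e^{c²/4} C_{b+1}` since `cosh(cu) e^{bu²} ≤ e^{c²/4} e^{(b+1)u²}`.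

References: R. B. Griffiths, J. Math. Phys. 8 (1967) 478–483 and 484–489 (the ghost spin);
C. M. Newman, CPAM 27 (1974) 143–159, §1.
-/

noncomputable section

namespace Summit.RiemannHypothesis.RiemannHypothesis.Theorems.LeeYangTelegraph

open MeasureTheory Filter Topology Complex
open Literature.Probability.LatticeModels

/-! ### Finite level: the ghost spin -/

section Finite

variable {n : ℕ}

/-- Summing out the first (ghost) bit of a configuration on `Fin (n + 1)`. [folklore] -/
private theorem sum_config_succ {M : Type*} [AddCommMonoid M] (F : (Fin (n + 1) → Bool) → M) :
    ∑ s, F s = ∑ s : Fin n → Bool, (F (Fin.cons true s) + F (Fin.cons false s)) := by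
  rw [← Fintype.sum_equiv (Fin.consEquiv fun _ => Bool) (fun p => F (Fin.cons p.1 p.2)) F
    (fun p => rfl), Fintype.sum_prod_type, Fintype.sum_bool, Finset.sum_add_distrib]

/-- `cosh x ≤ e^{|x|}`. [folklore] -/
private theorem cosh_le_exp_abs (x : ℝ) : Real.cosh x ≤ Real.exp |x| := by
  rw [Real.cosh_eq]
  have h1 : Real.exp x ≤ Real.exp |x| := Real.exp_le_exp.2 (le_abs_self x)
  have h2 : Real.exp (-x) ≤ Real.exp |x| := Real.exp_le_exp.2 (neg_le_abs x)
  linarith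

/-- **Ghost-spin energy**: with a spin `0` of couplings `J' 0 (succ i) = J' (succ i) 0 = c wᵢ / 2`,
`J' 0 0 = 0` and `J' (succ i) (succ j) = Jᵢⱼ`, the energy of `s` is
`E_J(tail s) + c s₀ M_w(tail s)`.
[cite: Griffiths1967, ghost spin] -/
private theorem isingPairEnergy_ghost (J : Fin n → Fin n → ℝ) (w : Fin n → ℝ) (c : ℝ)
    {J' : Fin (n + 1) → Fin (n + 1) → ℝ} (h00 : J' 0 0 = 0) (h0s : ∀ j, J' 0 j.succ = c * w j / 2)
    (hs0 : ∀ i, J' i.succ 0 = c * w i / 2) (hss : ∀ i j, J' i.succ j.succ = J i j)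
    (s : Fin (n + 1) → Bool) :
    isingPairEnergy J' s = isingPairEnergy J (Fin.tail s) +
      c * spinVal s 0 * weightedMagnetization w (Fin.tail s) := by
  have hsv : ∀ i, spinVal (Fin.tail s) i = spinVal s i.succ := fun i => rfl
  simp only [isingPairEnergy, weightedMagnetization, Fin.sum_univ_succ, h00, h0s, hs0, hss, hsv,
    zero_mul, zero_add]
  have h1 : ∑ j, c * w j / 2 * spinVal s 0 * spinVal s j.succ =
      c * spinVal s 0 / 2 * ∑ i, w i * spinVal s i.succ := by
    rw [Finset.mul_sum]; exact Finset.sum_congr rfl fun i _ => by ring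
  have h2 : ∑ i, c * w i / 2 * spinVal s i.succ * spinVal s 0 =
      c * spinVal s 0 / 2 * ∑ i, w i * spinVal s i.succ := by
    rw [Finset.mul_sum]; exact Finset.sum_congr rfl fun i _ => by ring
  rw [Finset.sum_add_distrib, h1, h2]
  ring

/-- Summing out the ghost spin multiplies the Boltzmann weight by `2 cosh(c M)`:
`B'(true :: s) + B'(false :: s) = 2 B_s cosh(c M_s)`. [cite: Griffiths1967, ghost spin] -/
private theorem isingBoltzmann_ghost_sum (J : Fin n → Fin n → ℝ) (w : Fin n → ℝ) (c : ℝ)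
    {J' : Fin (n + 1) → Fin (n + 1) → ℝ} (h00 : J' 0 0 = 0) (h0s : ∀ j, J' 0 j.succ = c * w j / 2)
    (hs0 : ∀ i, J' i.succ 0 = c * w i / 2) (hss : ∀ i j, J' i.succ j.succ = J i j)
    (s : Fin n → Bool) :
    isingBoltzmann J' (Fin.cons true s) + isingBoltzmann J' (Fin.cons false s) =
      2 * (isingBoltzmann J s * Real.cosh (c * weightedMagnetization w s)) := by
  have ht : spinVal (Fin.cons true s : Fin (n + 1) → Bool) 0 = 1 := by simp [spinVal]
  have hf : spinVal (Fin.cons false s : Fin (n + 1) → Bool) 0 = -1 := by simp [spinVal]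
  simp only [isingBoltzmann, isingPairEnergy_ghost J w c h00 h0s hs0 hss, Fin.tail_cons, ht, hf,
    Real.cosh_eq, Real.exp_add]
  ring_nf

/-- **Ghost spin = `cosh` tilt** (finite level): for the ghost system `(J', w')` of `(J, w, c)`
(`w' 0 = 0`, `w' (succ i) = wᵢ`),
`∫ f d(law J' w') = (∫ cosh(cu) f(u) d(law J w)) / ∫ cosh(cu) d(law J w)`.
[cite: Griffiths1967, ghost spin] -/
private theorem integral_isingMagnetizationLaw_ghost (J : Fin n → Fin n → ℝ) (w : Fin n → ℝ)
    (c : ℝ) {J' : Fin (n + 1) → Fin (n + 1) → ℝ} {w' : Fin (n + 1) → ℝ} (h00 : J' 0 0 = 0)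
    (h0s : ∀ j, J' 0 j.succ = c * w j / 2) (hs0 : ∀ i, J' i.succ 0 = c * w i / 2)
    (hss : ∀ i j, J' i.succ j.succ = J i j) (hw0 : w' 0 = 0) (hws : ∀ i, w' i.succ = w i)
    {f : ℝ → ℝ} (hf : StronglyMeasurable f) :
    ∫ u, f u ∂(isingMagnetizationLaw (n + 1) J' w' : Measure ℝ) =
      (∫ u, Real.cosh (c * u) * f u ∂(isingMagnetizationLaw n J w : Measure ℝ)) /
        ∫ u, Real.cosh (c * u) ∂(isingMagnetizationLaw n J w : Measure ℝ) := by
  -- the magnetization does not see the ghost spin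
  have hM : ∀ s : Fin (n + 1) → Bool,
      weightedMagnetization w' s = weightedMagnetization w (Fin.tail s) := by
    intro s
    have hsv : ∀ i, spinVal (Fin.tail s) i = spinVal s i.succ := fun i => rfl
    simp only [weightedMagnetization, Fin.sum_univ_succ, hw0, hws, zero_mul, zero_add, hsv]
  have hG := isingBoltzmann_ghost_sum J w c h00 h0s hs0 hss
  have hcosh : Continuous fun u : ℝ => Real.cosh (c * u) := by fun_prop
  -- the ghost partition function
  have hZ' : isingPairPartition J' =
      2 * ∑ s, isingBoltzmann J s * Real.cosh (c * weightedMagnetization w s) := by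
    rw [isingPairPartition, sum_config_succ, Finset.mul_sum]
    exact Finset.sum_congr rfl fun s _ => hG s
  rw [integral_isingMagnetizationLaw_eq_sum J' w' hf,
    integral_isingMagnetizationLaw_eq_sum J w (f := fun u => Real.cosh (c * u) * f u)
      (hcosh.stronglyMeasurable.mul hf),
    integral_isingMagnetizationLaw_eq_sum J w hcosh.stronglyMeasurable, sum_config_succ]
  simp only [hM, Fin.tail_cons, smul_eq_mul, div_mul_eq_mul_div, ← add_div, ← Finset.sum_div]
  rw [div_div_div_cancel_right₀ (isingPairPartition_pos J).ne', hZ']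
  have hnum : ∑ s, (isingBoltzmann J' (Fin.cons true s) * f (weightedMagnetization w s) +
      isingBoltzmann J' (Fin.cons false s) * f (weightedMagnetization w s)) =
      2 * ∑ s, isingBoltzmann J s * (Real.cosh (c * weightedMagnetization w s) *
        f (weightedMagnetization w s)) := by
    rw [Finset.mul_sum]
    refine Finset.sum_congr rfl fun s _ => ?_
    rw [← add_mul, hG s]
    ring
  rw [hnum, mul_div_mul_left _ _ (two_ne_zero' ℝ)]

end Finite

/-! ### Limit level -/

/-- Along a weakly convergent sequence of probability measures with bounded `e^{u²}`-moments,
`∫ cosh(cu) f(u) dν_k → ∫ cosh(cu) f(u) dν` for every bounded continuous real `f`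
(`tendsto_integral_of_tendsto_of_exp_sq_bound` with `g = cosh(cu) f(u) / (B + 1)`,
`|g| ≤ e^{|c| |u|}`). [folklore] -/
private theorem tendsto_integral_cosh_mul {νs : ℕ → ProbabilityMeasure ℝ}
    {ν : ProbabilityMeasure ℝ} (hlim : Tendsto νs atTop (𝓝 ν)) {C : ℝ}
    (hint : ∀ k, Integrable (fun u => Real.exp (u ^ 2)) (νs k : Measure ℝ))
    (hC : ∀ k, ∫ u, Real.exp (u ^ 2) ∂(νs k : Measure ℝ) ≤ C) (c : ℝ) {f : ℝ → ℝ}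
    (hf : Continuous f) {B : ℝ} (hB : ∀ u, |f u| ≤ B) :
    Tendsto (fun k => ∫ u, Real.cosh (c * u) * f u ∂(νs k : Measure ℝ)) atTop
      (𝓝 (∫ u, Real.cosh (c * u) * f u ∂(ν : Measure ℝ))) := by
  have hB1 : 0 < B + 1 := by linarith [(abs_nonneg _).trans (hB 0)]
  have hg : Continuous fun u : ℝ => ((Real.cosh (c * u) * f u / (B + 1) : ℝ) : ℂ) := by fun_prop
  have hgA : ∀ u, ‖((Real.cosh (c * u) * f u / (B + 1) : ℝ) : ℂ)‖ ≤ Real.exp (|c| * |u|) := by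
    intro u
    rw [Complex.norm_real, Real.norm_eq_abs, abs_div, abs_mul, abs_of_pos (Real.cosh_pos _),
      abs_of_pos hB1, div_le_iff₀ hB1]
    have h1 : Real.cosh (c * u) ≤ Real.exp (|c| * |u|) := by
      rw [← abs_mul]; exact cosh_le_exp_abs _
    have h2 : |f u| ≤ B + 1 := by linarith [hB u]
    exact mul_le_mul h1 h2 (abs_nonneg _) (Real.exp_pos _).le
  have h := tendsto_integral_of_tendsto_of_exp_sq_bound hlim hint hC hg hgA
  simp only [integral_complex_ofReal] at h
  have h2 := ((Complex.continuous_re.tendsto _).comp h).mul_const (B + 1)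
  simp only [Function.comp_def, Complex.ofReal_re, integral_div, div_mul_cancel₀ _ hB1.ne'] at h2
  exact h2

/-- **Ghost spin** (Griffiths 1967): `IsIsingLimitLaw` is closed under the tilt
`ν ↦ cosh(cu) ν / ∫ cosh(cu) dν` for `c ≥ 0`. Finite level: one extra spin of weight `0` coupled
ferromagnetically by `c wᵢ / 2` to every site multiplies the Gibbs weights, after summing it out, by
`2 cosh(c M)` and leaves the magnetization unchanged; limit level: the tilted integrals converge by
`tendsto_integral_of_tendsto_of_exp_sq_bound` (`cosh(cu) ≤ e^{c|u|}`, denominators `≥ 1`) and the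
Gaussian-exponential moments stay bounded (`cosh(cu) e^{bu²} ≤ e^{c²/4} e^{(b+1)u²}`).
[cite: Griffiths1967, ghost spin] -/
theorem stub_coshTilt (c : ℝ) (hc : 0 ≤ c) (ν ν' : ProbabilityMeasure ℝ) (hν : IsIsingLimitLaw ν)
    (h : (ν' : Measure ℝ) = (∫⁻ u, ENNReal.ofReal (Real.cosh (c * u)) ∂(ν : Measure ℝ))⁻¹ •
        (ν : Measure ℝ).withDensity (fun u => ENNReal.ofReal (Real.cosh (c * u)))) :
    IsIsingLimitLaw ν' := by
  obtain ⟨n, J, w, hJ, hw, hlim, hmom⟩ := hν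
  -- `e^{u²}` moments along the witness sequence and for the limit
  obtain ⟨C₁, hC₁⟩ := hmom 1
  have hC : ∀ k,
      ∫ u, Real.exp (u ^ 2) ∂(isingMagnetizationLaw (n k) (J k) (w k) : Measure ℝ) ≤ C₁ :=
    fun k => by simpa only [one_mul] using hC₁ k
  have hint : ∀ k, Integrable (fun u => Real.exp (u ^ 2))
      (isingMagnetizationLaw (n k) (J k) (w k) : Measure ℝ) :=
    fun k => integrable_exp_sq_isingMagnetizationLaw (J k) (w k)
  have hcosh : Continuous fun u : ℝ => Real.cosh (c * u) := by fun_prop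
  have hdom : ∀ u, Real.cosh (c * u) ≤ Real.exp (c ^ 2 / 4) * Real.exp (u ^ 2) := fun u =>
    (cosh_le_exp_abs _).trans (by rw [abs_mul, abs_of_nonneg hc]; exact exp_mul_abs_le c u)
  have hIν : Integrable (fun u => Real.exp (u ^ 2)) (ν : Measure ℝ) := by
    have h1 := (integrable_exp_mul_sq_of_tendsto hlim (b := 1) (C := C₁)
      (fun k => by simpa only [one_mul] using hint k) hC₁).1
    simpa only [one_mul] using h1
  have hcoshν : Integrable (fun u => Real.cosh (c * u)) (ν : Measure ℝ) :=
    (hIν.const_mul _).mono' hcosh.aestronglyMeasurable (Eventually.of_forall fun u => by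
      rw [Real.norm_of_nonneg (Real.cosh_pos _).le]; exact hdom u)
  have hD1 : 1 ≤ ∫ u, Real.cosh (c * u) ∂(ν : Measure ℝ) := by
    have h1 := integral_mono (integrable_const (1 : ℝ)) hcoshν fun u => Real.one_le_cosh (c * u)
    simpa using h1
  -- integrals against the tilted law `ν'`
  have hν' : ∀ f : ℝ → ℝ, ∫ u, f u ∂(ν' : Measure ℝ) =
      (∫ u, Real.cosh (c * u) * f u ∂(ν : Measure ℝ)) /
        ∫ u, Real.cosh (c * u) ∂(ν : Measure ℝ) := by
    intro f
    have hmeas : Measurable fun u => ENNReal.ofReal (Real.cosh (c * u)) :=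
      hcosh.measurable.ennreal_ofReal
    rw [h, integral_smul_measure, integral_withDensity_eq_integral_toReal_smul hmeas
      (Eventually.of_forall fun _ => ENNReal.ofReal_lt_top),
      ← ofReal_integral_eq_lintegral_ofReal hcoshν
        (Eventually.of_forall fun u => (Real.cosh_pos _).le),
      ENNReal.toReal_inv, ENNReal.toReal_ofReal (by linarith), smul_eq_mul, div_eq_inv_mul]
    congr 1
    refine integral_congr_ae (Eventually.of_forall fun u => ?_)
    dsimp only
    rw [ENNReal.toReal_ofReal (Real.cosh_pos _).le, smul_eq_mul]
  -- the ghost systems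
  obtain ⟨J', h00, h0s, hs0, hss⟩ : ∃ J' : ∀ k, Fin (n k + 1) → Fin (n k + 1) → ℝ,
      (∀ k, J' k 0 0 = 0) ∧ (∀ k j, J' k 0 j.succ = c * w k j / 2) ∧
        (∀ k i, J' k i.succ 0 = c * w k i / 2) ∧ ∀ k i j, J' k i.succ j.succ = J k i j :=
    ⟨fun k => Fin.cons (Fin.cons 0 fun j => c * w k j / 2)
        fun i => Fin.cons (c * w k i / 2) (J k i),
      fun _ => rfl, fun _ _ => rfl, fun _ _ => rfl, fun _ _ _ => rfl⟩
  obtain ⟨w', hw0, hws⟩ : ∃ w' : ∀ k, Fin (n k + 1) → ℝ,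
      (∀ k, w' k 0 = 0) ∧ ∀ k i, w' k i.succ = w k i :=
    ⟨fun k => Fin.cons 0 (w k), fun _ => rfl, fun _ _ => rfl⟩
  have hghost : ∀ k {f : ℝ → ℝ}, StronglyMeasurable f →
      ∫ u, f u ∂(isingMagnetizationLaw (n k + 1) (J' k) (w' k) : Measure ℝ) =
        (∫ u, Real.cosh (c * u) * f u ∂(isingMagnetizationLaw (n k) (J k) (w k) : Measure ℝ)) /
          ∫ u, Real.cosh (c * u) ∂(isingMagnetizationLaw (n k) (J k) (w k) : Measure ℝ) :=
    fun k _ hf => integral_isingMagnetizationLaw_ghost (J k) (w k) c (h00 k) (h0s k) (hs0 k)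
      (hss k) (hw0 k) (hws k) hf
  refine ⟨fun k => n k + 1, J', w', ?_, ?_, ?_, ?_⟩
  · -- ferromagnetic
    intro k i j
    refine Fin.cases ?_ (fun i => ?_) i <;> refine Fin.cases ?_ (fun j => ?_) j
    · rw [h00]
    · rw [h0s]; exact div_nonneg (mul_nonneg hc (hw k j)) zero_le_two
    · rw [hs0]; exact div_nonneg (mul_nonneg hc (hw k i)) zero_le_two
    · rw [hss]; exact hJ k i j
  · -- non-negative weights
    intro k i
    refine Fin.cases ?_ (fun i => ?_) i
    · rw [hw0]
    · rw [hws]; exact hw k i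
  · -- weak convergence to the tilted law
    rw [ProbabilityMeasure.tendsto_iff_forall_integral_tendsto]
    intro f
    have hfB : ∀ u, |f u| ≤ ‖f‖ := fun u => by
      simpa only [Real.norm_eq_abs] using f.norm_coe_le_norm u
    have hN := tendsto_integral_cosh_mul hlim hint hC c f.continuous hfB
    have hD := tendsto_integral_cosh_mul hlim hint hC c continuous_const (f := fun _ => (1 : ℝ))
      (B := 1) fun u => by simp
    simp only [mul_one] at hD
    rw [hν' f]
    refine (hN.div hD (by linarith)).congr fun k => ?_
    exact (hghost k f.continuous.stronglyMeasurable).symm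
  · -- uniform Gaussian-exponential moments
    intro b
    obtain ⟨Cb, hCb⟩ := hmom (b + 1)
    refine ⟨Real.exp (c ^ 2 / 4) * Cb, fun k => ?_⟩
    have hexpb : Continuous fun u : ℝ => Real.exp (b * u ^ 2) := by fun_prop
    rw [hghost k hexpb.stronglyMeasurable]
    have hDk1 :
        1 ≤ ∫ u, Real.cosh (c * u) ∂(isingMagnetizationLaw (n k) (J k) (w k) : Measure ℝ) := by
      have h1 := integral_mono (integrable_const (1 : ℝ))
        (integrable_isingMagnetizationLaw (J k) (w k) hcosh.stronglyMeasurable)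
        fun u => Real.one_le_cosh (c * u)
      simpa using h1
    have hNk0 : 0 ≤ ∫ u, Real.cosh (c * u) * Real.exp (b * u ^ 2)
        ∂(isingMagnetizationLaw (n k) (J k) (w k) : Measure ℝ) :=
      integral_nonneg fun u => mul_nonneg (Real.cosh_pos _).le (Real.exp_pos _).le
    refine (div_le_self hNk0 hDk1).trans ?_
    calc ∫ u, Real.cosh (c * u) * Real.exp (b * u ^ 2)
          ∂(isingMagnetizationLaw (n k) (J k) (w k) : Measure ℝ)
        ≤ ∫ u, Real.exp (c ^ 2 / 4) * Real.exp ((b + 1) * u ^ 2)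
          ∂(isingMagnetizationLaw (n k) (J k) (w k) : Measure ℝ) := by
          refine integral_mono (integrable_isingMagnetizationLaw (J k) (w k)
            (hcosh.stronglyMeasurable.mul hexpb.stronglyMeasurable))
            (integrable_isingMagnetizationLaw (J k) (w k)
              (by fun_prop : Continuous fun u : ℝ =>
                Real.exp (c ^ 2 / 4) * Real.exp ((b + 1) * u ^ 2)).stronglyMeasurable) fun u => ?_
          dsimp only
          calc Real.cosh (c * u) * Real.exp (b * u ^ 2)
              ≤ Real.exp (c ^ 2 / 4) * Real.exp (u ^ 2) * Real.exp (b * u ^ 2) := by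
                gcongr; exact hdom u
            _ = Real.exp (c ^ 2 / 4) * Real.exp ((b + 1) * u ^ 2) := by
                rw [mul_assoc, ← Real.exp_add]; ring_nf
      _ = Real.exp (c ^ 2 / 4) *
          ∫ u, Real.exp ((b + 1) * u ^ 2) ∂(isingMagnetizationLaw (n k) (J k) (w k) : Measure ℝ) :=
          integral_const_mul _ _
      _ ≤ Real.exp (c ^ 2 / 4) * Cb := by gcongr; exact hCb k

end Summit.RiemannHypothesis.RiemannHypothesis.Theorems.LeeYangTelegraph

end
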